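import Literature.MathematicalPhysics.QuantumLattice.LocalTubeUniqueness
import Literature.MathematicalPhysics.QuantumLattice.WightmanPermutedTubeLocal
import Literature.MathematicalPhysics.QuantumFieldTheory.OSLocality
import HarnessLib

/-!
# Boundary values of permuted Wightman functions on a local tube

Topic `Literature/MathematicalPhysics/QuantumLattice` (trunk T-AQFT). The analytic step of the
two-dimensional case of the symmetry of the Schwinger functions
(`IsWickRotationOf.schwinger_symmetric`, `SchwingerWightman`; OS I §5 p. 97, S–W Thm. 3-6), in a
dimension-free abstract form. Let `𝔚` be analytic on the extended relative tube `𝒯'ₙ`,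
`L₊(ℂ)`-invariant there, with distributional boundary value `T` from `𝒯ₙ` and polynomial growth at
the edge (`HasEdgeGrowth`). Fix a permutation `σ`, an open set `O` of real configurations and an
open convex cone `Γ'` of imaginary parts. A **local-tube key** for `σ` (`LocalTubeKey`) assigns to
every point `x + iy`, `x ∈ O`, `y ∈ Γ'`, `‖y‖ < γ`, a transformation `Λ ∈ L₊(ℂ)` taking the permuted
point `(x + iy) ∘ σ` into the forward tube `𝒯ₙ`, in the ray form `x' + i‖y‖η'` with `‖x'‖ ≤ R'`,
margins of `η'` at least `κ₃ > 0` and `‖η'‖ ≤ C₄` (for the Schwinger functions in `d = 1` these are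
imaginary Lorentz boosts with point-dependent angles, `SchwingerSymmetryTwoDim`; compare the local
commutativity theorem of `OSLocalTube`, whose pattern this file follows). Then:

* `LocalTubeKey.mem_and_apply_eq`: `(x + iy) ∘ σ ∈ 𝒯'ₙ` and `𝔚((x + iy) ∘ σ) = 𝔚(x' + i‖y‖η')`
  (invariance); `LocalTubeKey.exists_bound`: `‖𝔚((x + iy) ∘ σ)‖ ≤ C ‖y‖^{-r}` on the local tube
  (edge growth on the compact set of directions `{margins ≥ κ₃, ‖η'‖ ≤ C₄}`);
* `LocalTubeKey.tendsto_integral` (**the boundary value from the local tube**): for `φ` smooth and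
  compactly supported in `O`, `∫ φ(x) 𝔚((x + iy) ∘ σ) dx → T(φ ∘ (· ∘ σ⁻¹))` as `y → 0` within `Γ'`
  — existence of the limit by Hörmander's Thm. 3.1.15 (`tendsto_integral_of_norm_le_inv_pow`),
  identification along one ray `y = tη_σ` with `η_σ ∈ Γ'`, `η_σ ∘ σ` in the base cone
  (`tendsto_perm_of_hasDistributionalBoundaryValue`);
* `eqOn_perm_of_localTubeKey` (**agreement of two permuted branches on a local tube**): if `τ` and
  `π` both have keys on `(O, Γ', γ)`, `O` is convex, and `T(φ ∘ (· ∘ τ⁻¹)) = T(φ ∘ (· ∘ π⁻¹))` for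
  all `φ` compactly supported in `O` (locality), then `𝔚(z ∘ τ) = 𝔚(z ∘ π)` on the whole local
  tube `localTube O Γ' γ` (the boundary values of the difference vanish, and
  `eq_zero_on_localTube_of_rayBoundaryValue_zero`, Hörmander Thm. 3.1.15 / S–W Thm. 2-17 on a
  local tube, applies).

## References

* K. Osterwalder, R. Schrader, Comm. Math. Phys. 31 (1973), §4.5, §5 p. 97. [OsterwalderSchraderCMP1973]
* R. F. Streater, A. S. Wightman, *PCT, Spin and Statistics, and All That* (1964), Thms. 2-10,
  2-17, 3-6. [StreaterWightman1964]
* L. Hörmander, *The Analysis of Linear Partial Differential Operators I* (1990), Thm. 3.1.15.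
  [HormanderALPDO1]
-/

noncomputable section

open MeasureTheory Filter Complex Set Metric
open _root_.Topology
open scoped SchwartzMap ContDiff
open Literature.MathematicalPhysics.QuantumFieldTheory Literature.Analysis.Distribution

namespace Literature.MathematicalPhysics.QuantumLattice

variable {d n : ℕ}

/-! ### Complex boosts as elements of `L₊(ℂ)` -/

/-- The coordinate complex boost `B_i(w)` acting diagonally on configurations is the action of an
element of the proper complex Lorentz group. [folklore] -/
theorem exists_lorentz_eq_boostConfig (i : Fin d) (w : ℂ) :
    ∃ Λ ∈ properComplexLorentzGroup d, ∀ z : Fin n → Fin (d + 1) → ℂ,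
      (fun k => Λ (z k)) = boostConfig n i w z := by
  obtain ⟨he, hs, hes⟩ := frame_e₀_single (d := d) i
  refine ⟨planeBoostEquiv he hs hes w, planeBoostEquiv_mem_properComplexLorentzGroup he hs hes _,
    fun z => ?_⟩
  funext k
  rw [planeBoostEquiv_apply, boostConfig_apply, boostC_eq_planeBoost]

/-- **Transport into the tube.** If `𝔚` is `L₊(ℂ)`-invariant on `𝒯'ₙ` and `Λ z ∈ 𝒯ₙ` for some
`Λ ∈ L₊(ℂ)`, then `z ∈ 𝒯'ₙ` and `𝔚 z = 𝔚 (Λ z)`. [folklore] -/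
theorem mem_relExtendedTube_and_apply_eq_of_lorentz {𝔚 : (Fin n → Fin (d + 1) → ℂ) → ℂ}
    (hinv : ∀ Λ ∈ properComplexLorentzGroup d, ∀ z ∈ relExtendedTube d n,
      𝔚 (fun k => Λ (z k)) = 𝔚 z)
    {Λ : (Fin (d + 1) → ℂ) ≃ₗ[ℂ] (Fin (d + 1) → ℂ)} (hΛ : Λ ∈ properComplexLorentzGroup d)
    {z : Fin n → Fin (d + 1) → ℂ} (hΛz : (fun k => Λ (z k)) ∈ forwardTube d n) :
    z ∈ relExtendedTube d n ∧ 𝔚 z = 𝔚 (fun k => Λ (z k)) := by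
  have h1 : (fun k => Λ (z k)) ∈ relExtendedTube d n :=
    relForwardTube_subset_relExtendedTube (QuantumFieldTheory.forwardTube_subset_relForwardTube hΛz)
  have h2 := lorentz_mem_relExtendedTube h1 (Subgroup.inv_mem _ hΛ)
  have h3 : (fun k => Λ⁻¹ ((fun k => Λ (z k)) k)) = z := by
    funext k
    exact LinearEquiv.symm_apply_apply Λ (z k)
  rw [h3] at h2
  exact ⟨h2, (hinv Λ hΛ z h2).symm⟩

/-! ### Local-tube keys -/

variable (d) in
/-- **A local-tube key for the permutation `σ`** on the real set `O`, the cone of imaginary parts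
`Γ'` and the size `γ`, with constants `κ₃, R', C₄`: every permuted point `(x + iy) ∘ σ`, `x ∈ O`,
`y ∈ Γ'`, `‖y‖ < γ`, is taken by some `Λ ∈ L₊(ℂ)` to a point of the ray form `x' + i‖y‖η'` with
`‖x'‖ ≤ R'`, all margins of `η'` at least `κ₃` (so `x' + i‖y‖η' ∈ 𝒯ₙ` when `κ₃ > 0`) and
`‖η'‖ ≤ C₄`. [folklore] -/
def LocalTubeKey (σ : Equiv.Perm (Fin n)) (O Γ' : Set (Fin n → SpaceTime d)) (γ κ₃ R' C₄ : ℝ) :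
    Prop :=
  ∀ x ∈ O, ∀ y ∈ Γ', ‖y‖ < γ → ∃ Λ ∈ properComplexLorentzGroup d,
    ∃ x' η' : Fin n → SpaceTime d, ‖x'‖ ≤ R' ∧ (∀ k, κ₃ ≤ coneMargin (succDiff η' k)) ∧ ‖η'‖ ≤ C₄ ∧
      (fun k => Λ (rayC x y I (σ k))) =
        fun k => complexifyPoint (x' k) + ((‖y‖ : ℂ) * I) • complexifyPoint (η' k)

namespace LocalTubeKey

variable {𝔚 : (Fin n → Fin (d + 1) → ℂ) → ℂ} {T : 𝓢((Fin n → SpaceTime d), ℂ) →L[ℂ] ℂ}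
  {σ : Equiv.Perm (Fin n)} {O Γ' : Set (Fin n → SpaceTime d)} {γ κ₃ R' C₄ : ℝ}

/-- The ray form of a key lies in the forward tube when `κ₃ > 0` and `y ≠ 0`. [folklore] -/
theorem ray_mem_forwardTube (hκ₃ : 0 < κ₃) {x' η' y : Fin n → SpaceTime d} (hy : y ≠ 0)
    (hη' : ∀ k, κ₃ ≤ coneMargin (succDiff η' k)) :
    (fun k => complexifyPoint (x' k) + ((‖y‖ : ℂ) * I) • complexifyPoint (η' k)) ∈ forwardTube d n :=
  mem_forwardTube_of_mem_tubeCone x' η'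
    (fun k => (mem_forwardCone_iff_coneMargin_pos _).2 (hκ₃.trans_le (hη' k))) (norm_pos_iff.2 hy)

/-- **Under a key, the permuted local-tube points lie in `𝒯'ₙ` and `𝔚` takes there the value at
the ray form** (`L₊(ℂ)`-invariance). [folklore] -/
theorem mem_and_apply_eq (hkey : LocalTubeKey d σ O Γ' γ κ₃ R' C₄) (hκ₃ : 0 < κ₃)
    (hΓ'0 : (0 : Fin n → SpaceTime d) ∉ Γ')
    (hinv : ∀ Λ ∈ properComplexLorentzGroup d, ∀ z ∈ relExtendedTube d n,
      𝔚 (fun k => Λ (z k)) = 𝔚 z)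
    {x y : Fin n → SpaceTime d} (hx : x ∈ O) (hy : y ∈ Γ') (hyγ : ‖y‖ < γ) :
    (fun k => rayC x y I (σ k)) ∈ relExtendedTube d n ∧
      ∃ x' η' : Fin n → SpaceTime d, ‖x'‖ ≤ R' ∧ (∀ k, κ₃ ≤ coneMargin (succDiff η' k)) ∧
        ‖η'‖ ≤ C₄ ∧ 𝔚 (fun k => rayC x y I (σ k)) =
          𝔚 (fun k => complexifyPoint (x' k) + ((‖y‖ : ℂ) * I) • complexifyPoint (η' k)) := by
  obtain ⟨Λ, hΛ, x', η', hx', hη', hη'n, hEq⟩ := hkey x hx y hy hyγ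
  have hy0 : y ≠ 0 := fun h => hΓ'0 (h ▸ hy)
  have hmemT : (fun k => Λ ((fun k => rayC x y I (σ k)) k)) ∈ forwardTube d n := by
    rw [show (fun k => Λ ((fun k => rayC x y I (σ k)) k)) = fun k => Λ (rayC x y I (σ k)) from rfl,
      hEq]
    exact ray_mem_forwardTube hκ₃ hy0 hη'
  obtain ⟨hmem, hval⟩ := mem_relExtendedTube_and_apply_eq_of_lorentz hinv hΛ hmemT
  refine ⟨hmem, x', η', hx', hη', hη'n, ?_⟩
  rw [hval]
  exact congrArg 𝔚 hEq

/-- **Growth on the local tube**: under a key with `κ₃ > 0` and `γ ≤ 1/2`, the edge growth of `𝔚`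
gives `‖𝔚((x + iy) ∘ σ)‖ ≤ C ‖y‖^{-r}` for `x ∈ O`, `y ∈ Γ'`, `‖y‖ < γ`. [folklore] -/
theorem exists_bound (hkey : LocalTubeKey d σ O Γ' γ κ₃ R' C₄) (hκ₃ : 0 < κ₃) (hγ : γ ≤ 1 / 2)
    (hΓ'0 : (0 : Fin n → SpaceTime d) ∉ Γ')
    (hinv : ∀ Λ ∈ properComplexLorentzGroup d, ∀ z ∈ relExtendedTube d n,
      𝔚 (fun k => Λ (z k)) = 𝔚 z)
    (hgrowth : HasEdgeGrowth 𝔚) :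
    ∃ (C : ℝ) (r : ℕ), ∀ x ∈ O, ∀ y ∈ Γ', ‖y‖ < γ →
      ‖𝔚 (fun k => rayC x y I (σ k))‖ ≤ C * ‖y‖⁻¹ ^ r := by
  -- the compact set of directions and the growth constants
  obtain ⟨K, hK⟩ : ∃ K : Set (Fin n → SpaceTime d),
      K = {η | (∀ k, κ₃ ≤ coneMargin (succDiff η k)) ∧ ‖η‖ ≤ C₄} := ⟨_, rfl⟩
  have hKc : IsCompact K := hK ▸ isCompact_dirSet κ₃ C₄
  have hKΓ : K ⊆ tubeCone d n := hK ▸ dirSet_subset_tubeCone hκ₃ C₄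
  obtain ⟨C, r, hC⟩ := hgrowth K hKc hKΓ R'
  refine ⟨|C|, r, fun x hx y hy hyγ => ?_⟩
  have hy0 : 0 < ‖y‖ := norm_pos_iff.2 fun h => hΓ'0 (h ▸ hy)
  have hy1 : ‖y‖ < 1 := hyγ.trans_le (hγ.trans (by norm_num))
  obtain ⟨-, x', η', hx', hη'1, hη'2, hEq⟩ := hkey.mem_and_apply_eq hκ₃ hΓ'0 hinv hx hy hyγ
  rw [hEq]
  have hη' : η' ∈ K := by rw [hK]; exact ⟨hη'1, hη'2⟩
  exact (hC x' hx' η' hη' ‖y‖ hy0 hy1).trans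
    (mul_le_mul_of_nonneg_right (le_abs_self C) (by positivity))

/-- Rays `t ↦ tη`, `η ∈ Γ'`, tend to `0` within the cone `Γ'`. [folklore] -/
theorem tendsto_smul_nhdsWithin (hΓ'cone : ∀ s : ℝ, 0 < s → ∀ y ∈ Γ', s • y ∈ Γ')
    {η : Fin n → SpaceTime d} (hη : η ∈ Γ') :
    Tendsto (fun t : ℝ => t • η) (𝓝[>] 0) (𝓝[Γ'] 0) := by
  refine tendsto_nhdsWithin_iff.2 ⟨?_, ?_⟩
  · have hc : Continuous fun t : ℝ => t • η := continuous_id.smul continuous_const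
    have h0 : Tendsto (fun t : ℝ => t • η) (𝓝 0) (𝓝 ((0 : ℝ) • η)) := hc.tendsto 0
    rw [zero_smul] at h0
    exact h0.mono_left nhdsWithin_le_nhds
  · exact eventually_nhdsWithin_of_forall fun t ht => hΓ'cone t ht η hη

/-- The permuted branch `z ↦ 𝔚 (z ∘ σ)` is complex differentiable on the open set
`{z | z ∘ σ ∈ 𝒯'ₙ}`. [folklore] -/
theorem differentiableOn_perm (h𝔚 : AnalyticOnNhd ℂ 𝔚 (relExtendedTube d n))
    (σ : Equiv.Perm (Fin n)) :
    DifferentiableOn ℂ (fun z : Fin n → Fin (d + 1) → ℂ => 𝔚 (fun k => z (σ k)))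
      ((permConfig d n σ) ⁻¹' relExtendedTube d n) := fun z hz =>
  ((h𝔚 _ hz).comp (analyticAt_permConfig σ z)).differentiableAt.differentiableWithinAt

/-- **The boundary value of a permuted branch from the local tube.** Under a key for `σ` on
`(O, Γ', γ)` (`Γ'` an open convex cone not containing `0`, `γ ≤ 1/2`, `κ₃ > 0`), with `𝔚` analytic
and `L₊(ℂ)`-invariant on `𝒯'ₙ`, with boundary value `T` and edge growth, and a direction
`η_σ ∈ Γ'` with `η_σ ∘ σ` in the base cone: for every smooth `φ` compactly supported in `O`,
`∫ φ(x) 𝔚((x + iy) ∘ σ) dx → T(φ ∘ (· ∘ σ⁻¹))` as `y → 0` within `Γ'` (Hörmander Thm. 3.1.15 for the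
existence of the limit, the ray `y = tη_σ` and the boundary value of `𝔚` for its value).
[cite: HormanderALPDO1, Thm 3.1.15] -/
theorem tendsto_integral (hkey : LocalTubeKey d σ O Γ' γ κ₃ R' C₄) (hκ₃ : 0 < κ₃)
    (hγpos : 0 < γ) (hγ : γ ≤ 1 / 2)
    (hΓ'o : IsOpen Γ') (hΓ'c : Convex ℝ Γ') (hΓ'cone : ∀ s : ℝ, 0 < s → ∀ y ∈ Γ', s • y ∈ Γ')
    (hΓ'0 : (0 : Fin n → SpaceTime d) ∉ Γ')
    (h𝔚 : AnalyticOnNhd ℂ 𝔚 (relExtendedTube d n)) (hbv : HasDistributionalBoundaryValue 𝔚 T)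
    (hinv : ∀ Λ ∈ properComplexLorentzGroup d, ∀ z ∈ relExtendedTube d n,
      𝔚 (fun k => Λ (z k)) = 𝔚 z)
    (hgrowth : HasEdgeGrowth 𝔚) {ησ : Fin n → SpaceTime d} (hησΓ' : ησ ∈ Γ')
    (hησ : (fun k => ησ (σ k)) ∈ tubeCone d n)
    {φ : (Fin n → SpaceTime d) → ℂ} (hφ : ContDiff ℝ ∞ φ) (hφc : HasCompactSupport φ)
    (hφO : tsupport φ ⊆ O) :
    Tendsto (fun y : Fin n → SpaceTime d => ∫ x, φ x * 𝔚 (fun k => rayC x y I (σ k)))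
      (𝓝[Γ'] 0) (𝓝 (T (permTest σ⁻¹ (hφc.toSchwartzMap hφ)))) := by
  -- growth and membership on the local tube
  obtain ⟨C, r, hC⟩ := hkey.exists_bound hκ₃ hγ hΓ'0 hinv hgrowth
  have hform : ∀ x y : Fin n → SpaceTime d,
      cpxConfigCLM d n x + (I : ℂ) • cpxConfigCLM d n y = rayC x y I := fun x y => rfl
  set f : (Fin n → Fin (d + 1) → ℂ) → ℂ := fun z => 𝔚 (fun k => z (σ k)) with hf
  have hU : IsOpen ((permConfig d n σ) ⁻¹' relExtendedTube d n) :=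
    isOpen_relExtendedTube.preimage (permConfig d n σ).continuous
  have htube : ∀ x ∈ O, ∀ y ∈ Γ', ‖y‖ < γ →
      cpxConfigCLM d n x + (I : ℂ) • cpxConfigCLM d n y ∈ (permConfig d n σ) ⁻¹' relExtendedTube d n := by
    intro x hx y hy hyγ
    rw [hform]
    show permConfig d n σ (rayC x y I) ∈ relExtendedTube d n
    have h := (hkey.mem_and_apply_eq hκ₃ hΓ'0 hinv hx hy hyγ).1
    have h' : permConfig d n σ (rayC x y I) = fun k => rayC x y I (σ k) :=
      funext fun k => permConfig_apply σ _ k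
    rw [h']
    exact h
  have hbound : ∀ x ∈ O, ∀ y ∈ Γ', ‖y‖ < γ →
      ‖f (cpxConfigCLM d n x + (I : ℂ) • cpxConfigCLM d n y)‖ ≤ C * ‖y‖⁻¹ ^ r := by
    intro x hx y hy hyγ
    rw [hform]
    exact hC x hx y hy hyγ
  -- Hörmander's theorem: the boundary value of `f` from `Γ'` exists
  obtain ⟨ℓ, hℓ⟩ := tendsto_integral_of_norm_le_inv_pow (μ := volume) (J := cpxConfigCLM d n)
    hU (differentiableOn_perm h𝔚 σ) hΓ'o hΓ'c hΓ'cone hΓ'0 hγpos htube hbound hφ hφc hφO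
  -- identification along the ray `y = t η_σ`
  set F : 𝓢((Fin n → SpaceTime d), ℂ) := hφc.toSchwartzMap hφ with hF
  have hFφ : ∀ x, F x = φ x := fun x => rfl
  have hlim : ℓ = T (permTest σ⁻¹ F) := by
    have hA := hℓ.comp (tendsto_smul_nhdsWithin hΓ'cone hησΓ')
    have hB := tendsto_perm_of_hasDistributionalBoundaryValue hbv σ hησ F
    refine tendsto_nhds_unique hA (hB.congr' ?_)
    refine eventually_nhdsWithin_of_forall fun t (ht : 0 < t) => ?_
    simp only [Function.comp_apply]
    refine integral_congr_ae (Eventually.of_forall fun x => ?_)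
    beta_reduce
    rw [hform, ← rayC_ofReal_mul_I, hFφ, mul_comm]
    rfl
  rw [← hlim]
  refine hℓ.congr' (Eventually.of_forall fun y => ?_)
  refine integral_congr_ae (Eventually.of_forall fun x => ?_)
  beta_reduce
  rw [hform]

end LocalTubeKey

/-! ### Agreement of two permuted branches on a local tube -/

/-- A product `φ · g` is integrable when `φ` is continuous with compact support and `g` is
continuous at the points of `tsupport φ`. [folklore] -/
theorem integrable_mul_of_continuousAt_tsupport {φ g : (Fin n → SpaceTime d) → ℂ}
    (hφ : Continuous φ) (hφc : HasCompactSupport φ) (hg : ∀ x ∈ tsupport φ, ContinuousAt g x) :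
    Integrable (fun x => φ x * g x) (volume : Measure (Fin n → SpaceTime d)) := by
  have hc : Continuous fun x => g x * φ x := continuous_mul_of_continuousAt_tsupport hg hφ
  have h : Integrable (fun x => g x * φ x) (volume : Measure (Fin n → SpaceTime d)) :=
    hc.integrable_of_hasCompactSupport hφc.mul_left
  exact h.congr (Eventually.of_forall fun x => mul_comm _ _)

/-- **Agreement of two permuted branches of `𝔚` on a local tube.** Let `𝔚` be analytic and
`L₊(ℂ)`-invariant on `𝒯'ₙ` with boundary value `T` and edge growth; let `τ`, `π` have local-tube
keys on `(O, Γ', γ)` (`O` open convex, `Γ'` an open convex cone, `0 ∉ Γ'`, `γ ≤ 1/2`) with ray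
directions `η_τ, η_π ∈ Γ'`, `η_τ ∘ τ` and `η_π ∘ π` in the base cone; and suppose
`T(φ ∘ (· ∘ τ⁻¹)) = T(φ ∘ (· ∘ π⁻¹))` for every smooth `φ` compactly supported in `O` (local
commutativity). Then `𝔚(z ∘ τ) = 𝔚(z ∘ π)` for all `z ∈ localTube O Γ' γ`: the difference is
holomorphic on the local tube, its boundary values from `Γ'` vanish, so it vanishes
(`eq_zero_on_localTube_of_rayBoundaryValue_zero`). This is the Euclidean-point instance of "`W` and
`W_π` continue one another" (S–W Thm. 3-6) that needs no real point of `𝒯'ₙ ∩ σ𝒯'ₙ`.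
[cite: StreaterWightman1964, Thm 3-6] [cite: HormanderALPDO1, Thm 3.1.15] -/
theorem eqOn_perm_of_localTubeKey {𝔚 : (Fin n → Fin (d + 1) → ℂ) → ℂ}
    {T : 𝓢((Fin n → SpaceTime d), ℂ) →L[ℂ] ℂ} {τ π : Equiv.Perm (Fin n)}
    {O Γ' : Set (Fin n → SpaceTime d)} {γ κ₃ R' C₄ κ₃' R'' C₄' : ℝ}
    (hτ : LocalTubeKey d τ O Γ' γ κ₃ R' C₄) (hπ : LocalTubeKey d π O Γ' γ κ₃' R'' C₄')
    (hκ₃ : 0 < κ₃) (hκ₃' : 0 < κ₃') (hγpos : 0 < γ) (hγ : γ ≤ 1 / 2)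
    (hOo : IsOpen O) (hOc : Convex ℝ O)
    (hΓ'o : IsOpen Γ') (hΓ'c : Convex ℝ Γ') (hΓ'cone : ∀ s : ℝ, 0 < s → ∀ y ∈ Γ', s • y ∈ Γ')
    (hΓ'0 : (0 : Fin n → SpaceTime d) ∉ Γ')
    (h𝔚 : AnalyticOnNhd ℂ 𝔚 (relExtendedTube d n)) (hbv : HasDistributionalBoundaryValue 𝔚 T)
    (hinv : ∀ Λ ∈ properComplexLorentzGroup d, ∀ z ∈ relExtendedTube d n,
      𝔚 (fun k => Λ (z k)) = 𝔚 z)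
    (hgrowth : HasEdgeGrowth 𝔚)
    {ητ : Fin n → SpaceTime d} (hητΓ' : ητ ∈ Γ') (hητ : (fun k => ητ (τ k)) ∈ tubeCone d n)
    {ηπ : Fin n → SpaceTime d} (hηπΓ' : ηπ ∈ Γ') (hηπ : (fun k => ηπ (π k)) ∈ tubeCone d n)
    (hloc : ∀ (φ : (Fin n → SpaceTime d) → ℂ) (hφ : ContDiff ℝ ∞ φ) (hφc : HasCompactSupport φ),
      tsupport φ ⊆ O →
      T (permTest τ⁻¹ (hφc.toSchwartzMap hφ)) = T (permTest π⁻¹ (hφc.toSchwartzMap hφ)))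
    {z : Fin n → Fin (d + 1) → ℂ} (hz : z ∈ localTube O Γ' γ) :
    𝔚 (fun k => z (τ k)) = 𝔚 (fun k => z (π k)) := by
  -- the difference of the two branches
  set H : (Fin n → Fin (d + 1) → ℂ) → ℂ := fun z => 𝔚 (fun k => z (τ k)) - 𝔚 (fun k => z (π k))
    with hH
  -- the local tube lies in both permuted extended tubes
  have hmem : ∀ σ : Equiv.Perm (Fin n), ∀ {κ R C : ℝ}, LocalTubeKey d σ O Γ' γ κ R C → 0 < κ →
      ∀ w ∈ localTube O Γ' γ, (fun k => w (σ k)) ∈ relExtendedTube d n := by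
    intro σ κ R C hkey hκ w hw
    obtain ⟨hx, hy, hyγ⟩ := mem_localTube_iff.1 hw
    have h := (hkey.mem_and_apply_eq hκ hΓ'0 hinv hx hy hyγ).1
    rwa [rayC_reConfigCLM_imConfigCLM] at h
  -- `H` is holomorphic on the local tube
  have hHd : DifferentiableOn ℂ H (localTube O Γ' γ) := by
    refine DifferentiableOn.sub (fun w hw => ?_) (fun w hw => ?_)
    · exact ((h𝔚 _ (hmem τ hτ hκ₃ w hw)).comp (analyticAt_permConfig τ w)).differentiableAt
        |>.differentiableWithinAt
    · exact ((h𝔚 _ (hmem π hπ hκ₃' w hw)).comp (analyticAt_permConfig π w)).differentiableAt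
        |>.differentiableWithinAt
  -- the ray boundary values of `H` vanish
  have hlim : ∀ η ∈ Γ', ∀ φ : (Fin n → SpaceTime d) → ℂ, ContDiff ℝ ∞ φ → HasCompactSupport φ →
      tsupport φ ⊆ O →
      Tendsto (fun t : ℝ => ∫ x, H (rayC x η ((t : ℂ) * I)) * φ x) (𝓝[>] 0) (𝓝 0) := by
    intro η hη φ hφ hφc hφO
    have h1 := hτ.tendsto_integral hκ₃ hγpos hγ hΓ'o hΓ'c hΓ'cone hΓ'0 h𝔚 hbv hinv hgrowth hητΓ' hητ
      hφ hφc hφO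
    have h2 := hπ.tendsto_integral hκ₃' hγpos hγ hΓ'o hΓ'c hΓ'cone hΓ'0 h𝔚 hbv hinv hgrowth hηπΓ' hηπ
      hφ hφc hφO
    rw [hloc φ hφ hφc hφO] at h1
    have h12 := (h1.sub h2).comp (LocalTubeKey.tendsto_smul_nhdsWithin hΓ'cone hη)
    rw [sub_self] at h12
    -- for small `t > 0` the ray lies in the local tube, where the integrands are continuous
    have hev : ∀ᶠ t : ℝ in 𝓝[>] 0, 0 < t ∧ t * ‖η‖ < γ := by
      refine (eventually_nhdsWithin_of_forall fun t ht => ht).and ?_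
      have : Tendsto (fun t : ℝ => t * ‖η‖) (𝓝[>] 0) (𝓝 0) := by
        have hc : Continuous fun t : ℝ => t * ‖η‖ := continuous_id.mul continuous_const
        have h := hc.tendsto 0
        rw [zero_mul] at h
        exact h.mono_left nhdsWithin_le_nhds
      exact this.eventually (gt_mem_nhds hγpos)
    refine h12.congr' ?_
    filter_upwards [hev] with t ⟨ht, htγ⟩
    simp only [Function.comp_apply]
    have hy : t • η ∈ Γ' := hΓ'cone t ht η hη
    have hyγ : ‖t • η‖ < γ := by rwa [norm_smul, Real.norm_eq_abs, abs_of_pos ht]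
    -- continuity of the two branches at the points of the ray over `tsupport φ`
    have hcont : ∀ σ : Equiv.Perm (Fin n), ∀ {κ R C : ℝ}, LocalTubeKey d σ O Γ' γ κ R C → 0 < κ →
        ∀ x ∈ tsupport φ, ContinuousAt (fun x' => 𝔚 (fun k => rayC x' (t • η) I (σ k))) x := by
      intro σ κ R C hkey hκ x hx
      have hw : rayC x (t • η) I ∈ localTube O Γ' γ :=
        rayC_I_mem_localTube_iff.2 ⟨hφO hx, hy, hyγ⟩
      have hE := hmem σ hkey hκ _ hw
      have h1 : ContinuousAt (fun z : Fin n → Fin (d + 1) → ℂ => 𝔚 (fun k => z (σ k)))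
          (rayC x (t • η) I) :=
        ((h𝔚 _ hE).comp (analyticAt_permConfig σ _)).continuousAt
      exact h1.comp' (f := fun x' => rayC x' (t • η) I) (continuous_rayC_left (t • η) I).continuousAt
    have hi1 : Integrable fun x => φ x * 𝔚 (fun k => rayC x (t • η) I (τ k)) :=
      integrable_mul_of_continuousAt_tsupport hφ.continuous hφc (hcont τ hτ hκ₃)
    have hi2 : Integrable fun x => φ x * 𝔚 (fun k => rayC x (t • η) I (π k)) :=
      integrable_mul_of_continuousAt_tsupport hφ.continuous hφc (hcont π hπ hκ₃')
    rw [← integral_sub hi1 hi2]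
    refine integral_congr_ae (Eventually.of_forall fun x => ?_)
    simp only [hH, rayC_ofReal_mul_I]
    ring
  exact sub_eq_zero.1 (eq_zero_on_localTube_of_rayBoundaryValue_zero hOo hOc hΓ'o hΓ'c hΓ'cone hHd
    hlim hz)

end Literature.MathematicalPhysics.QuantumLattice
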